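import Literature.Computability.AlgebraicComplexity.DDS21TranscriptDilation
import Literature.Computability.AlgebraicComplexity.DDS21Thm32Assembly
import Literature.Computability.AlgebraicComplexity.UABPDescent
import Literature.Computability.AlgebraicComplexity.DDS21EpsIntegralGraded
import Literature.Computability.AlgebraicComplexity.DDS21DilationGradeZero
import HarnessLib

/-!
# DDS21 Thm. 3.2 final assembly: the trace-back transcript INSTANTIATED from a graded-frame
# residue chain (seam decision (α′))

Theorem-only file (cell `val-lit`, np lane, RULINGS (142)(a)/(144)(a): "the per-round
instantiation is p1's"). Source: P. Dutta, P. Dwivedi, N. Saxena, *Demystifying the border of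
depth-3 algebraic circuits*, FOCS 2021, full version `paper:galaxy-pdf-7641649743695546420`, §3
proof of Thm. 3.2 (p0028 L748 – p0036 L964) [DuttaDwivediSaxena2022].

INPUT (the `F(x)`-side of the DiDIL induction, with NO `ε` — what the bricks E2 (residue chain,
x5 g8), E3 (de-bordered divisor / end pairs, t19 g12) and E4 (graded `z = 0` values, valuations;
t21 g13) deliver over the working field `K`):
* the input polynomial `f` and the shift `α` ("`Φ : x_i ↦ z·x_i + α_i`", p0028 L751–754);
* the RESIDUE CHAIN `f_0 = f(x+α)`, `f_{j+1} = E(f_j / t_j)` in `K(x)` ("`f_1 := ∂_z(Φ(f_0)/t)`",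
  Claims 3.4/3.5 — B4a's `eulerFrac`) with the divisor residues `t_j = tn_j / td_j` given by
  polynomial representatives with programs and the VALUATION DATA `ldeg tn_j = ldeg td_j + [j ≥ 1]`
  (`[j ≥ 1] = min j 1`; print: `v = 0` after "`T =: z^v·T̃`", p0030 L804–808, in the Euler frame);
* Claim 3.8's values `(f_j/t_j)|_{z=0} = Nw_j/ew_j` in the currency `GradeZero` of
  `DDS21EpsIntegralGraded.lean` (p0035 L934–941), with programs;
* the END PAIR `f_r = N₀/D₀` with programs (Claim 3.3 at the last stage, "`f_{k−1} ∈ ABP/ABP`").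

OUTPUT (`exists_transcript_of_residueChain`; and ★ `DDS2021_thm_3_2_of_residueChain` = its
composition with `DDS2021_thm_3_2_of_transcript_fractionRing` of `DDS21Thm32Assembly.lean`: the
named fact from the residue chain over the generic-point field `Frac F[y]`, architecture (A′)):
EXACTLY the hypothesis list of the trace-back
export of record `uabpComputes_of_traceBackTranscript_lin'` (`DDS21TraceBackAssembly.lean`, t24
g13) — equivalently the body of the ONE hypothesis of `DDS2021_thm_3_2_of_transcript`
(`DDS21Thm32Assembly.lean`): divisors `A_j, B_j` = `ldeg`-shifted dilations (`DDS21TranscriptDilation`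
§1) with `z = 0` slices the initial forms, `N, E` by the trace-back recursion, `hw0` from the `GradeZero` models through t18 g11's slice bridge `hw0_of_gradeZero`
(`DDS21DilationGradeZero.lean`), the TOP pair from `exists_top_pair`, all programs within `(σ+1)^7`, the top
congruence at EVERY precision.

0 definitions, 0 named facts. Honest framing: plumbing of a published proof; `DDS2021_thm_3_2`
stays OPEN by name (the residue chain with these properties is the producers' side); VP ≠ VNP is
NOT proved and nothing here bears on it.

## References

* [DuttaDwivediSaxena2022] P. Dutta, P. Dwivedi, N. Saxena, *Demystifying the border of depth-3
  algebraic circuits*, Proc. 62nd FOCS (2021), IEEE 2022, 92–103; full version §3: Φ (p0028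
  L751–757), (3.1)–(3.2) (p0029 L766 – p0030 L812), Claims 3.4–3.5 (p0029 L772 – p0031 L834),
  Claim 3.7 (p0034 L897–913), Claim 3.8 (p0035 L934–941), "Size blowup" (p0036 L952–961).
-/

noncomputable section

open MvPolynomial
open Literature.RingTheory.MvPolynomial
open scoped BigOperators

namespace Literature.Computability.AlgebraicComplexity

namespace DDS2021

section Instantiation

variable {K : Type*} [Field K] {n : ℕ}

/-- The `z = 0` slice of a product through the slices of the factors (`T_1` is multiplicative up
to `T_1`). [cite: DuttaDwivediSaxena2022, §3 proof of Thm. 3.2, Claim 3.7 (full version p0034 L906–913)] -/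
theorem truncDegreeOf_one_mul_of_slices {P Q : MvPolynomial (Fin (n + 1)) K} {p q : MvPolynomial (Fin n) K}
    (hP : truncDegreeOf 0 1 P = rename Fin.succ p) (hQ : truncDegreeOf 0 1 Q = rename Fin.succ q) :
    truncDegreeOf 0 1 (P * Q) = rename Fin.succ (p * q) := by
  rw [truncDegreeOf_mul, hP, hQ, ← map_mul]
  exact truncDegreeOf_eq_self_of_degreeOf_eq_zero (degreeOf_zero_rename_succ _) Nat.one_pos

/-- The `z = 0` slice of a `z`-free polynomial. [cite: DuttaDwivediSaxena2022, §3 proof of Thm. 3.2, Claim 3.7 (full version p0034 L906–913)] -/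
theorem truncDegreeOf_one_rename_succ (p : MvPolynomial (Fin n) K) :
    truncDegreeOf 0 1 (rename Fin.succ p : MvPolynomial (Fin (n + 1)) K) = rename Fin.succ p :=
  truncDegreeOf_eq_self_of_degreeOf_eq_zero (degreeOf_zero_rename_succ _) Nat.one_pos

/-- Arithmetic for the program budgets. [cite: DuttaDwivediSaxena2022, §3 "Size blowup" (full version p0036 L952–958)] -/
private theorem le_succ_pow_seven {σ a : ℕ} (hσ : 2 ≤ σ) (ha : a ≤ σ * (σ + 1)) : a ≤ (σ + 1) ^ 7 := by
  refine ha.trans ?_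
  calc σ * (σ + 1) ≤ (σ + 1) * (σ + 1) := Nat.mul_le_mul_right _ (Nat.le_succ σ)
    _ = (σ + 1) ^ 2 := by ring
    _ ≤ (σ + 1) ^ 7 := Nat.pow_le_pow_right (by omega) (by norm_num)

/-- **★ The trace-back transcript INSTANTIATED from a residue chain** (seam decision (α′), RULING
(144)(a); see the module docstring for the dictionary). From the graded-frame data — input `f`,
shift `α`, residue chain `f_0 = f(x+α)`, `f_{j+1} = E(f_j/t_j)` with divisor representatives
`t_j = tn_j/td_j` (`ldeg tn_j = ldeg td_j + [j ≥ 1]`), Claim 3.8 values `GradeZero (f_j/t_j) (Nw_j/ew_j)`,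
end pair `f_r = N₀/D₀`, programs within `σ` — the `z`-frame transcript of
`uabpComputes_of_traceBackTranscript_lin'`: divisors `A_j := dil_{ldeg} tn_j`, `B_j := dil_{ldeg} td_j`
(slices = initial forms), `N, E` by the trace-back recursion from `N_0 = Φ_α(f)`, `hw0`, the top
identity `N_r · Bt = At · E_r` (every precision), programs within `(σ+1)^7`.
[cite: DuttaDwivediSaxena2022, §3 proof of Thm. 3.2: Φ (full version p0028 L751–757), (3.1)–(3.2) (p0029 L766 – p0030 L812), Claim 3.7 (p0034 L897–913), Claim 3.8 (p0035 L934–941)] -/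
theorem exists_transcript_of_residueChain {r σ : ℕ} (f : MvPolynomial (Fin n) K) (α : Fin n → K)
    (fres : ℕ → FractionRing (MvPolynomial (Fin n) K)) (tn td Nw ew : ℕ → MvPolynomial (Fin n) K)
    (N₀ D₀ : MvPolynomial (Fin n) K)
    (h0 : fres 0 = algebraMap _ _ (aeval (fun i : Fin n => (X i + C (α i) : MvPolynomial (Fin n) K)) f))
    (hstep : ∀ j < r, fres (j + 1) = eulerFrac (Fin n) K _
      (fres j / (algebraMap _ _ (tn j) / algebraMap _ _ (td j))))
    (htn : ∀ j < r, tn j ≠ 0) (htd : ∀ j < r, td j ≠ 0)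
    (hval : ∀ j < r, ldeg (tn j) = ldeg (td j) + min j 1)
    (hw : ∀ j < r, GradeZero (fres j / (algebraMap _ _ (tn j) / algebraMap _ _ (td j)))
      (algebraMap _ _ (Nw j) / algebraMap _ _ (ew j)))
    (hew : ∀ j < r, ew j ≠ 0)
    (hend : fres r = algebraMap _ _ N₀ / algebraMap _ _ D₀) (hD₀ : D₀ ≠ 0)
    (hP : ∀ j < r, UABPComputes σ (tn j) ∧ UABPComputes σ (td j) ∧
      UABPComputes σ (Nw j) ∧ UABPComputes σ (ew j))
    (hdeg : ∀ j < r, (tn j).totalDegree ≤ σ ∧ (td j).totalDegree ≤ σ)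
    (hN₀P : UABPComputes σ N₀) (hD₀P : UABPComputes σ D₀) (hN₀d : N₀.totalDegree ≤ σ)
    (hD₀d : D₀.totalDegree ≤ σ) (hσ : 2 ≤ σ) :
    ∃ (N E A B : ℕ → MvPolynomial (Fin (n + 1)) K) (a βn : ℕ → MvPolynomial (Fin n) K)
      (At Bt : MvPolynomial (Fin (n + 1)) K) (βt : MvPolynomial (Fin n) K),
      N 0 = aeval (fun i : Fin n => (X 0 * X i.succ + C (α i) : MvPolynomial (Fin (n + 1)) K)) f ∧
      E 0 = 1 ∧
      (∀ j < r, N (j + 1) = pderiv 0 (N j * B j) * (E j * A j) - N j * B j * pderiv 0 (E j * A j)) ∧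
      (∀ j < r, E (j + 1) = (E j * A j) ^ 2) ∧
      (∀ j < r, truncDegreeOf 0 1 (A j) = rename Fin.succ (a j) ∧
        truncDegreeOf 0 1 (B j) = rename Fin.succ (βn j) ∧ a j ≠ 0 ∧ βn j ≠ 0 ∧ ew j ≠ 0 ∧
        rename Fin.succ (ew j) * truncDegreeOf 0 1 (N j * B j) =
          rename Fin.succ (Nw j) * truncDegreeOf 0 1 (E j * A j) ∧
        UABPComputes ((σ + 1) ^ 7) (A j) ∧ UABPComputes ((σ + 1) ^ 7) (B j) ∧
        UABPComputes ((σ + 1) ^ 7) (a j) ∧ UABPComputes ((σ + 1) ^ 7) (βn j) ∧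
        UABPComputes ((σ + 1) ^ 7) (Nw j) ∧ UABPComputes ((σ + 1) ^ 7) (ew j)) ∧
      (∀ M, truncDegreeOf 0 M (N r * Bt) = truncDegreeOf 0 M (At * E r)) ∧
      truncDegreeOf 0 1 Bt = rename Fin.succ βt ∧ βt ≠ 0 ∧
      UABPComputes ((σ + 1) ^ 7) At ∧ UABPComputes ((σ + 1) ^ 7) Bt ∧ UABPComputes ((σ + 1) ^ 7) βt := by
  classical
  have hσ1 : 2 ≤ σ + 1 := by omega
  have hσle : σ ≤ (σ + 1) ^ 7 :=
    (Nat.le_succ σ).trans (Nat.le_self_pow (by norm_num) (σ + 1))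
  -- the divisors: shifted dilations
  set A : ℕ → MvPolynomial (Fin (n + 1)) K := fun j =>
    ∑ c ∈ Finset.range ((tn j).totalDegree + 1), (X 0 : MvPolynomial (Fin (n + 1)) K) ^ c *
      rename Fin.succ (homogeneousComponent (ldeg (tn j) + c) (tn j)) with hA
  set B : ℕ → MvPolynomial (Fin (n + 1)) K := fun j =>
    ∑ c ∈ Finset.range ((td j).totalDegree + 1), (X 0 : MvPolynomial (Fin (n + 1)) K) ^ c *
      rename Fin.succ (homogeneousComponent (ldeg (td j) + c) (td j)) with hB
  have hAd : ∀ j, (X 0 : MvPolynomial (Fin (n + 1)) K) ^ ldeg (tn j) * A j =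
      bind₁ (fun i : Fin n => (X 0 * X i.succ : MvPolynomial (Fin (n + 1)) K)) (tn j) := fun j =>
    (dilate_eq_X_pow_mul_dilShift_of_le_ldeg (tn j) (le_refl _)).symm
  have hBd : ∀ j, (X 0 : MvPolynomial (Fin (n + 1)) K) ^ ldeg (td j) * B j =
      bind₁ (fun i : Fin n => (X 0 * X i.succ : MvPolynomial (Fin (n + 1)) K)) (td j) := fun j =>
    (dilate_eq_X_pow_mul_dilShift_of_le_ldeg (td j) (le_refl _)).symm
  -- the virtual objects by the trace-back recursion
  let step : ℕ → MvPolynomial (Fin (n + 1)) K × MvPolynomial (Fin (n + 1)) K →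
      MvPolynomial (Fin (n + 1)) K × MvPolynomial (Fin (n + 1)) K := fun j p =>
    (pderiv 0 (p.1 * B j) * (p.2 * A j) - p.1 * B j * pderiv 0 (p.2 * A j), (p.2 * A j) ^ 2)
  let NE : ℕ → MvPolynomial (Fin (n + 1)) K × MvPolynomial (Fin (n + 1)) K := fun j =>
    Nat.rec (motive := fun _ => MvPolynomial (Fin (n + 1)) K × MvPolynomial (Fin (n + 1)) K)
      (aeval (fun i : Fin n => (X 0 * X i.succ + C (α i) : MvPolynomial (Fin (n + 1)) K)) f, 1) step j
  set N : ℕ → MvPolynomial (Fin (n + 1)) K := fun j => (NE j).1 with hN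
  set E : ℕ → MvPolynomial (Fin (n + 1)) K := fun j => (NE j).2 with hE
  have hN0 : N 0 = aeval (fun i : Fin n => (X 0 * X i.succ + C (α i) : MvPolynomial (Fin (n + 1)) K)) f := rfl
  have hE0 : E 0 = 1 := rfl
  have hNs : ∀ j < r, N (j + 1) = pderiv 0 (N j * B j) * (E j * A j) - N j * B j * pderiv 0 (E j * A j) :=
    fun j _ => rfl
  have hEs : ∀ j < r, E (j + 1) = (E j * A j) ^ 2 := fun j _ => rfl
  -- the Euler chain pushed by the dilation
  set g : ℕ → FractionRing (MvPolynomial (Fin (n + 1)) K) := fun j => dilFrac K n (fres j) with hg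
  have hg0 : g 0 = algebraMap _ _ (N 0) := by
    show dilFrac K n (fres 0) = _
    rw [h0, dilFrac_algebraMap, hN0, aeval_phi_eq_dilate_shift]
  have hgs : ∀ j < r, g (j + 1) = zDerivFrac K n (g j /
      (algebraMap _ _ (bind₁ (fun i : Fin n => (X 0 * X i.succ : MvPolynomial (Fin (n + 1)) K)) (tn j)) /
        algebraMap _ _ (bind₁ (fun i : Fin n => (X 0 * X i.succ : MvPolynomial (Fin (n + 1)) K)) (td j)))) := by
    intro j hj
    show dilFrac K n (fres (j + 1)) = zDerivFrac K n (dilFrac K n (fres j) / _)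
    rw [hstep j hj, dilFrac_eulerFrac]
    congr 1
    rw [map_div₀, map_div₀, dilFrac_algebraMap, dilFrac_algebraMap]
  -- slices and non-vanishing of the divisors
  have hAs : ∀ j, truncDegreeOf 0 1 (A j) = rename Fin.succ (initialForm (tn j)) := fun j =>
    truncDegreeOf_one_dilShift_ldeg (tn j)
  have hBs : ∀ j, truncDegreeOf 0 1 (B j) = rename Fin.succ (initialForm (td j)) := fun j =>
    truncDegreeOf_one_dilShift_ldeg (td j)
  -- programs for the divisors and slices
  have hAP : ∀ j < r, UABPComputes ((σ + 1) ^ 7) (A j) := fun j hj =>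
    ((hP j hj).1.mono (Nat.le_succ σ)).dilShift ((hdeg j hj).1.trans (Nat.le_succ σ))
      ((ldeg_le_totalDegree _).trans ((hdeg j hj).1.trans (Nat.le_succ σ))) hσ1
  have hBP : ∀ j < r, UABPComputes ((σ + 1) ^ 7) (B j) := fun j hj =>
    ((hP j hj).2.1.mono (Nat.le_succ σ)).dilShift ((hdeg j hj).2.trans (Nat.le_succ σ))
      ((ldeg_le_totalDegree _).trans ((hdeg j hj).2.trans (Nat.le_succ σ))) hσ1
  have haP : ∀ j < r, UABPComputes ((σ + 1) ^ 7) (initialForm (tn j)) := fun j hj =>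
    le_succ_pow_seven hσ (le_refl _) |> ((hP j hj).1.homogeneousComponent (D := σ)
      ((ldeg_le_totalDegree _).trans (hdeg j hj).1)).mono
  have hβP : ∀ j < r, UABPComputes ((σ + 1) ^ 7) (initialForm (td j)) := fun j hj =>
    le_succ_pow_seven hσ (le_refl _) |> ((hP j hj).2.1.homogeneousComponent (D := σ)
      ((ldeg_le_totalDegree _).trans (hdeg j hj).2)).mono
  -- the link lemma
  have hlink := link_of_recursion (r := r) tn td (fun j => ldeg (tn j)) (fun j => ldeg (td j)) A B N E g
    htn htd (fun j _ => hAd j) (fun j _ => hBd j) hval hE0 hNs hEs hg0 hgs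
  -- the `z = 0` slices of the virtual denominators `E_j` are nonzero and `z`-free
  have hEslice : ∀ j, j ≤ r → ∃ ej : MvPolynomial (Fin n) K,
      truncDegreeOf 0 1 (E j) = rename Fin.succ ej ∧ ej ≠ 0 := by
    intro j
    induction j with
    | zero =>
      intro _
      refine ⟨1, ?_, one_ne_zero⟩
      rw [hE0, ← (rename Fin.succ).map_one]
      exact truncDegreeOf_one_rename_succ 1
    | succ j ih =>
      intro hj
      obtain ⟨ej, hej, hej0⟩ := ih (by omega)
      have hjr : j < r := by omega
      refine ⟨(ej * initialForm (tn j)) * (ej * initialForm (tn j)), ?_,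
        mul_ne_zero (mul_ne_zero hej0 (initialForm_ne_zero (htn j hjr)))
          (mul_ne_zero hej0 (initialForm_ne_zero (htn j hjr)))⟩
      rw [hEs j hjr, sq]
      exact truncDegreeOf_one_mul_of_slices (truncDegreeOf_one_mul_of_slices hej (hAs j))
        (truncDegreeOf_one_mul_of_slices hej (hAs j))
  obtain ⟨er, her, her0⟩ := hEslice r le_rfl
  have hgr : g r = dilFrac K n (algebraMap _ _ N₀ / algebraMap _ _ D₀) := by
    show dilFrac K n (fres r) = _
    rw [hend]
  have hcross := cross_of_link (r := r) hD₀ (hlink r le_rfl).2 hgr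
  obtain ⟨At, Bt, htop, hβt, hβt0, hAtP, hBtP, hβtP⟩ :=
    exists_top_pair (s := σ + 1) (v := min r 1) hD₀ her
      (fun h => her0 (rename_injective _ (Fin.succ_injective n) (by rw [h, map_zero]))) hcross
      (hN₀P.mono (Nat.le_succ σ))
      (hD₀P.mono (Nat.le_succ σ)) (hN₀d.trans (Nat.le_succ σ)) (hD₀d.trans (Nat.le_succ σ))
      (by have := ldeg_le_totalDegree D₀; have := Nat.min_le_right r 1; omega) hσ1
  refine ⟨N, E, A, B, fun j => initialForm (tn j), fun j => initialForm (td j), At, Bt, initialForm D₀,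
    hN0, hE0, hNs, hEs, fun j hj => ⟨hAs j, hBs j, initialForm_ne_zero (htn j hj),
      initialForm_ne_zero (htd j hj), hew j hj, ?_, hAP j hj, hBP j hj, haP j hj, hβP j hj,
      (hP j hj).2.2.1.mono hσle, (hP j hj).2.2.2.mono hσle⟩,
    fun M => by rw [htop], hβt, initialForm_ne_zero hD₀, hAtP, hBtP, hβtP⟩
  -- `hw0` from the `GradeZero` model (t18 g11's slice bridge `hw0_of_gradeZero`)
  exact hw0_of_gradeZero (r := r) fres tn td Nw ew (fun j => ldeg (tn j)) (fun j => ldeg (td j)) A B N E g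
    htn hew (fun j _ => hAd j) (fun j _ => hBd j) hval (fun _ _ => rfl) hlink hw j hj

end Instantiation


/-! ## ★ The named fact from the RESIDUE CHAIN over the generic-point field (everything `z`-side discharged)

Composition of `exists_transcript_of_residueChain` with `DDS2021_thm_3_2_of_transcript_fractionRing`
(`DDS21Thm32Assembly.lean`): the transcript-existence hypothesis is replaced by the existence, over
`F′ = Frac F[y]`, of the graded-frame residue chain with its divisor/value/end data — the
producers' side of the DiDIL induction (stage 0, B4b, E2 chain, E3 end game, E4), with NO `z`. -/

section OfResidueChain

/-- **★ DDS Thm. 3.2 from the residue chain over the generic-point field.** If for some absolute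
`c₀`, every border-`Σ^{[k]}Π^{[d]}Σ` polynomial `f` over `F` (budget `s`) admits, over
`F′ = Frac F[y_1..y_n]` and for the base change `f′ = map f`, a shift `α`, a residue chain
`f_0 = f′(x+α)`, `f_{j+1} = E(f_j/t_j)` (`j < r`, some `r ≤ k − 1` rounds) with divisor representatives `t_j = tn_j/td_j`
(`tn_j, td_j ≠ 0`, `ldeg tn_j = ldeg td_j + min j 1`), Claim 3.8 values
`GradeZero (f_j/t_j) (Nw_j/ew_j)` (`ew_j ≠ 0`), an end pair `f_r = N₀/D₀` (`D₀ ≠ 0`), programs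
within `σ` and degrees `≤ σ` for `tn, td, Nw, ew, N₀, D₀`, with `2 ≤ σ`, `deg f′ + k ≤ σ` and
`(σ+1)^7 ≤ s^{c₀·7^{k−1}}` — then `DDS2021_thm_3_2` holds.
[cite: DuttaDwivediSaxena2022, Thm. 3.2 (full version p0026 L710–717) and its proof §3 (p0026 L713 – p0036 L964)] -/
theorem DDS2021_thm_3_2_of_residueChain
    (H : ∃ c₀ : ℕ, ∀ (F : Type) [Field F] [CharZero F] (n k d s : ℕ) (f : MvPolynomial (Fin n) F),
      1 ≤ k → k ≤ s → d ≤ s → n ≤ s → 2 ≤ s →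
        f ∈ border (spsClass (RatFunc F) n k d) →
          ∃ (r σ : ℕ) (α : Fin n → FractionRing (MvPolynomial (Fin n) F))
            (fres : ℕ → FractionRing (MvPolynomial (Fin n) (FractionRing (MvPolynomial (Fin n) F))))
            (tn td Nw ew : ℕ → MvPolynomial (Fin n) (FractionRing (MvPolynomial (Fin n) F)))
            (N₀ D₀ : MvPolynomial (Fin n) (FractionRing (MvPolynomial (Fin n) F))),
            r + 1 ≤ k ∧ (σ + 1) ^ 7 ≤ s ^ (c₀ * 7 ^ (k - 1)) ∧ 2 ≤ σ ∧
            (map (algebraMap F (FractionRing (MvPolynomial (Fin n) F))) f).totalDegree + k ≤ σ ∧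
            fres 0 = algebraMap (MvPolynomial (Fin n) (FractionRing (MvPolynomial (Fin n) F))) (FractionRing (MvPolynomial (Fin n) (FractionRing (MvPolynomial (Fin n) F)))) (aeval (fun i : Fin n => (X i + C (α i) :
              MvPolynomial (Fin n) (FractionRing (MvPolynomial (Fin n) F))))
                (map (algebraMap F (FractionRing (MvPolynomial (Fin n) F))) f)) ∧
            (∀ j < r, fres (j + 1) = eulerFrac (Fin n) (FractionRing (MvPolynomial (Fin n) F)) _
              (fres j / (algebraMap (MvPolynomial (Fin n) (FractionRing (MvPolynomial (Fin n) F))) (FractionRing (MvPolynomial (Fin n) (FractionRing (MvPolynomial (Fin n) F)))) (tn j) / algebraMap (MvPolynomial (Fin n) (FractionRing (MvPolynomial (Fin n) F))) (FractionRing (MvPolynomial (Fin n) (FractionRing (MvPolynomial (Fin n) F)))) (td j)))) ∧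
            (∀ j < r, tn j ≠ 0 ∧ td j ≠ 0 ∧ ldeg (tn j) = ldeg (td j) + min j 1 ∧
              GradeZero (fres j / (algebraMap (MvPolynomial (Fin n) (FractionRing (MvPolynomial (Fin n) F))) (FractionRing (MvPolynomial (Fin n) (FractionRing (MvPolynomial (Fin n) F)))) (tn j) / algebraMap (MvPolynomial (Fin n) (FractionRing (MvPolynomial (Fin n) F))) (FractionRing (MvPolynomial (Fin n) (FractionRing (MvPolynomial (Fin n) F)))) (td j)))
                (algebraMap (MvPolynomial (Fin n) (FractionRing (MvPolynomial (Fin n) F))) (FractionRing (MvPolynomial (Fin n) (FractionRing (MvPolynomial (Fin n) F)))) (Nw j) / algebraMap (MvPolynomial (Fin n) (FractionRing (MvPolynomial (Fin n) F))) (FractionRing (MvPolynomial (Fin n) (FractionRing (MvPolynomial (Fin n) F)))) (ew j)) ∧ ew j ≠ 0 ∧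
              UABPComputes σ (tn j) ∧ UABPComputes σ (td j) ∧ UABPComputes σ (Nw j) ∧
              UABPComputes σ (ew j) ∧ (tn j).totalDegree ≤ σ ∧ (td j).totalDegree ≤ σ) ∧
            fres r = algebraMap (MvPolynomial (Fin n) (FractionRing (MvPolynomial (Fin n) F))) (FractionRing (MvPolynomial (Fin n) (FractionRing (MvPolynomial (Fin n) F)))) N₀ / algebraMap (MvPolynomial (Fin n) (FractionRing (MvPolynomial (Fin n) F))) (FractionRing (MvPolynomial (Fin n) (FractionRing (MvPolynomial (Fin n) F)))) D₀ ∧ D₀ ≠ 0 ∧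
            UABPComputes σ N₀ ∧ UABPComputes σ D₀ ∧ N₀.totalDegree ≤ σ ∧ D₀.totalDegree ≤ σ) :
    DDS2021_thm_3_2 := by
  obtain ⟨c₀, H⟩ := H
  refine ⟨(c₀ + 2) * 2106, fun F _ _ n k d s f hk hks hds hns hs hf => ?_⟩
  haveI : CharZero (FractionRing (MvPolynomial (Fin n) F)) :=
    charZero_of_injective_algebraMap
      ((IsFractionRing.injective (MvPolynomial (Fin n) F) (FractionRing (MvPolynomial (Fin n) F))).comp
        (C_injective (Fin n) F) : Function.Injective
          (algebraMap F (FractionRing (MvPolynomial (Fin n) F))))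
  obtain ⟨r, σ, α, fres, tn, td, Nw, ew, N₀, D₀, hrk, hσs, hσ2, hdeg, h0, hstep, hround, hend, hD₀, hN₀P,
    hD₀P, hN₀d, hD₀d⟩ := H F n k d s f hk hks hds hns hs hf
  obtain ⟨N, E, A, B, a, βn, At, Bt, βt, hN0, hE0, hNs, hEs, hR, htop, hβt, hβt0, hAtP, hBtP, hβtP⟩ :=
    exists_transcript_of_residueChain (r := r) (σ := σ) _ α fres tn td Nw ew N₀ D₀ h0 hstep
      (fun j hj => (hround j hj).1) (fun j hj => (hround j hj).2.1) (fun j hj => (hround j hj).2.2.1)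
      (fun j hj => (hround j hj).2.2.2.1) (fun j hj => (hround j hj).2.2.2.2.1) hend hD₀
      (fun j hj => ⟨(hround j hj).2.2.2.2.2.1, (hround j hj).2.2.2.2.2.2.1, (hround j hj).2.2.2.2.2.2.2.1,
        (hround j hj).2.2.2.2.2.2.2.2.1⟩)
      (fun j hj => ⟨(hround j hj).2.2.2.2.2.2.2.2.2.1, (hround j hj).2.2.2.2.2.2.2.2.2.2⟩)
      hN₀P hD₀P hN₀d hD₀d hσ2
  have h7 : σ ≤ (σ + 1) ^ 7 := (Nat.le_succ σ).trans (Nat.le_self_pow (by norm_num) (σ + 1))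
  set σ₀ := (σ + 1) ^ 7 with hσ₀
  set D := (map (algebraMap F (FractionRing (MvPolynomial (Fin n) F))) f).totalDegree + k with hD
  have hσ₀2 : 2 ≤ σ₀ := hσ2.trans h7
  -- the trace-back over `F′`
  have hσ01 : σ₀ ≤ 3 ^ r * (4 * σ₀) :=
    (show σ₀ ≤ 4 * σ₀ by omega).trans (Nat.le_mul_of_pos_left _ (pow_pos (by norm_num) _))
  have hlin := uabpComputes_of_traceBackTranscript_lin' (r := r) (d := D) (σ₀ := σ₀)
    (σ₁ := 3 ^ r * (4 * σ₀)) _ α N E A B a βn Nw ew hN0 hE0 hNs hEs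
    (fun j hj => (hR j hj).1) (fun j hj => (hR j hj).2.1) (fun j hj => (hR j hj).2.2.1)
    (fun j hj => (hR j hj).2.2.2.1) (fun j hj => (hR j hj).2.2.2.2.1)
    (fun j hj => (hR j hj).2.2.2.2.2.1) (fun j hj => (hR j hj).2.2.2.2.2.2.1)
    (fun j hj => (hR j hj).2.2.2.2.2.2.2.1) (fun j hj => (hR j hj).2.2.2.2.2.2.2.2.1)
    (fun j hj => (hR j hj).2.2.2.2.2.2.2.2.2.1) (fun j hj => (hR j hj).2.2.2.2.2.2.2.2.2.2.1)
    (fun j hj => (hR j hj).2.2.2.2.2.2.2.2.2.2.2) (htop _) hβt hβt0 hAtP hBtP hβtP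
    (by omega) (by omega) (hdeg.trans h7) hσ₀2 hσ01 le_rfl
  -- budget: `σ₁ = 3^r·4σ₀ ≤ 3^(k−1)·4σ₀ ≤ s^((c₀+2)·7^(k−1))`, exponent `648 r + 1458 ≤ 648(k−1)+1458`
  have hσ₁ : 3 ^ r * (4 * σ₀) ≤ s ^ ((c₀ + 2) * 7 ^ (k - 1)) :=
    (Nat.mul_le_mul_right _ (Nat.pow_le_pow_right (by norm_num) (by omega : r ≤ k - 1))).trans
      (sigma_one_le_pow (c₀ := c₀) hs hk hσs)
  have h1s : 1 ≤ s ^ ((c₀ + 2) * 7 ^ (k - 1)) := Nat.one_le_pow _ _ (by omega)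
  have hmono : (3 ^ r * (4 * σ₀)) ^ (648 * r + 1458) ≤
      (s ^ ((c₀ + 2) * 7 ^ (k - 1))) ^ (648 * (k - 1) + 1458) :=
    (Nat.pow_le_pow_left hσ₁ _).trans (Nat.pow_le_pow_right h1s (by omega))
  refine (uabpComputes_descend_fractionRing f hlin).mono (hmono.trans ?_)
  refine (stagePow_le_pow (C := c₀ + 2) (a := 648) (b := 1458) (t := 7) (σ := s ^ ((c₀ + 2) * 7 ^ (k - 1)))
    (by omega) (by norm_num) hk le_rfl).trans (le_of_eq ?_)
  ring_nf

end OfResidueChain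

end DDS2021

end Literature.Computability.AlgebraicComplexity

end
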